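import Mathlib.MeasureTheory.Integral.IntervalIntegral.Basic
import Literature.Probability.Distributions.WeakConvergenceCDF
import Literature.Probability.Process.ContinuousMappingAE
import HarnessLib

/-!
# Window asymptotics ⇒ test-function asymptotics (the approximation step of BGSTB 2025, §7)

Topic `Literature/NumberTheory/LFunctions` (namespace `Literature.NumberTheory.LFunctions.AH`).
Theorems only: no definition, no named fact. LABEL (cell rh-crit, corpus C5): NOT RH-BEARING — a generic
weak-convergence lemma; nothing here bears on the truth of RH.

Baluyot–Goldston–Suriajaya–Turnage-Butterbaugh 2025, §7 (proof of Theorem 3, TeX l.1049–1090) passes from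
the WINDOW asymptotics of Lemma 6 — "(ii) `(1/2λ) ∫_{α−λ}^{α+λ} F(β) dβ = s(α) + O(λ) + …`" for `α ∉ ℤ`, and
the masses (i), (iii), (iv) at the integers — to integrals of `F` against a test function: "Thus by
approximation this also holds for any Riemann integrable function `g(α)`".  This file types that
approximation step as a generic real-analysis lemma on an integer-free interval (where only (ii) enters):
for a family of non-negative continuous densities `F_T` on `[u, v]`, a continuous non-negative limit density
`w`, and the hypothesis that the distribution functions converge, `∫_u^x F_T → ∫_u^x w` for every
`x ∈ [u, v]` (what (ii) gives after tiling `[u, x]` by windows), one has `∫_u^v F_T g → ∫_u^v w g` for every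
`g` "Riemann integrable on `[u, v]`" in the rendering of the typed `bgstb2025_theorem3` (bounded on `[u, v]`,
continuous within `[u, v]` at almost every point).

The proof goes through weak convergence rather than the paper's step functions: normalising `F_T dx` and
`w dx` on `(u, v]` to probability measures, the hypothesis says that their distribution functions converge
at every point, hence (Resnick, *A Probability Path*, Thm 8.4.1 (1) ⇒ (2); the tree's
`WeakConvergenceCDF.tendsto_of_forall_continuousAt_tendsto_cdf`) the measures converge weakly, and the
mapping theorem for a.e.-continuous maps (Billingsley 1999, Thm 2.7; the tree's
`ProbabilityMeasure.tendsto_map_of_ae_continuousAt`) applied to the bounded truncation of `g` gives the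
convergence of `∫ g`.

* `AH.aestronglyMeasurable_of_ae_continuousWithinAt` — the Lebesgue-criterion binder ⇒ a.e.-strong
  measurability on `[a, b]`;
* `AH.tendsto_intervalIntegral_mul_of_bounded` — the lemma for a globally bounded `ψ`, a.e.-continuous on
  `(u, v]`;
* `AH.tendsto_intervalIntegral_mul_of_tendsto_intervalIntegral` — the lemma with the binders of the typed
  Theorem 3 (`|g| ≤ B` on `[u, v]`, `∀ᵐ x ∂(vol|[u,v]), ContinuousWithinAt g [u,v] x`);
* `AH.abs_intervalIntegral_mul_sub_mul_le` — the window around an atom: `|∫ F g − g(m) ∫ F| ≤ ω ∫ F` for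
  `F ≥ 0` and `|g − g(m)| ≤ ω` on the window;
* `AH.tendsto_intervalIntegral_of_window` — the tiling step: uniform window averages (the shape of
  Lemma 6 (ii), `|(1/2λ)∫_{α−λ}^{α+λ} F_i − w(α)| ≤ ε` for all windows inside `[u, v]`, every `ε > 0`, all
  small `λ`, eventually along `l`) ⇒ the distribution-function hypothesis `∫_u^x F_i → ∫_u^x w`.

All statements are over an arbitrary (countably generated, where sequences are used) filter `l` on the
parameter: no `T → ∞` hard-wired and no AH-Pairs data (`M`, `R`, `δ`, `E_G`) inside — that bookkeeping
(including `M → ∞` and the bin-consistency of `P_0`) belongs to the Theorem-3 assembler.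

## References

* [BaluyotGoldstonSuriajayaTurnageButterbaugh2025] arXiv:2508.10857, §7 (proof of Theorem 3), TeX l.1049–1090
  (use-site only; the lemmas are generic). [claim: BaluyotGoldstonSuriajayaTurnageButterbaugh2025, status: under-review]
* [Resnick2014] S. I. Resnick, *A Probability Path*, Thm 8.4.1.
* [Billingsley1999] P. Billingsley, *Convergence of Probability Measures*, 2nd ed., Thm 2.7.
-/

noncomputable section

open MeasureTheory ProbabilityTheory Filter Set Topology
open scoped Topology ENNReal BoundedContinuousFunction Interval

namespace Literature.NumberTheory.LFunctions.AH

/-! ### Measurability from the Lebesgue-criterion binder -/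

/-- "Riemann integrable on `[a, b]`" as rendered in the typed `bgstb2025_theorem3` (continuous within `[a, b]`
at almost every point of `[a, b]`) implies a.e.-strong measurability on `[a, b]`.
[cite: BaluyotGoldstonSuriajayaTurnageButterbaugh2025, §7 (proof of Theorem 3, "any Riemann integrable function")] -/
theorem aestronglyMeasurable_of_ae_continuousWithinAt {a b : ℝ} {g : ℝ → ℝ}
    (hcont : ∀ᵐ x ∂(volume.restrict (Icc a b)), ContinuousWithinAt g (Icc a b) x) :
    AEStronglyMeasurable g (volume.restrict (Icc a b)) := by
  set μ : Measure ℝ := volume.restrict (Icc a b) with hμ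
  have hN : μ {x | ¬ContinuousWithinAt g (Icc a b) x} = 0 := ae_iff.1 hcont
  obtain ⟨N, hNsub, hNmeas, hN0⟩ := exists_measurable_superset_of_null hN
  set S : Set ℝ := Icc a b \ N with hS
  have hSmeas : MeasurableSet S := measurableSet_Icc.diff hNmeas
  have hgS : ContinuousOn g S := by
    intro x hx
    have hx' : ContinuousWithinAt g (Icc a b) x := by
      by_contra h
      exact hx.2 (hNsub h)
    exact hx'.mono sdiff_subset
  have hSae : S =ᵐ[volume] Icc a b := by
    refine ae_eq_set.2 ⟨?_, ?_⟩
    · rw [sdiff_eq_empty.2 sdiff_subset, measure_empty]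
    · have e : Icc a b \ S = N ∩ Icc a b := by
        ext x; simp only [hS, Set.mem_sdiff, mem_inter_iff]; tauto
      rw [e, ← Measure.restrict_apply hNmeas]
      exact hN0
  rw [hμ, ← Measure.restrict_congr_set hSae]
  exact hgS.aestronglyMeasurable hSmeas

/-! ### The normalised densities on `(u, v]` -/

/-- The distribution function of the normalised density `(f/c)·dx` on `(u, v]`:
`μ((−∞, x]) = (∫_u^{x'} f)/c` with `x' = max u (min x v)`. [folklore] -/
private theorem withDensity_Iic {u v : ℝ} (huv : u ≤ v) {f : ℝ → ℝ}
    (hfi : IntervalIntegrable f volume u v) (hf0 : ∀ x ∈ Icc u v, 0 ≤ f x) {c : ℝ} (hc : 0 < c)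
    (x : ℝ) :
    ((volume.restrict (Ioc u v)).withDensity (fun t => ENNReal.ofReal (f t / c))) (Iic x) =
      ENNReal.ofReal ((∫ t in u..(max u (min x v)), f t) / c) := by
  set x' : ℝ := max u (min x v) with hx'
  have hux' : u ≤ x' := le_max_left _ _
  have hx'v : x' ≤ v := max_le huv (min_le_right _ _)
  rw [withDensity_apply _ measurableSet_Iic, Measure.restrict_restrict measurableSet_Iic]
  have hset : Iic x ∩ Ioc u v = Ioc u x' := by
    ext t
    simp only [mem_inter_iff, mem_Iic, mem_Ioc, hx']
    constructor
    · rintro ⟨h1, h2, h3⟩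
      exact ⟨h2, le_max_of_le_right (le_min h1 h3)⟩
    · rintro ⟨h1, h2⟩
      have h3 : t ≤ min x v := by
        by_contra h
        push Not at h
        exact absurd h2 (not_le.2 (max_lt h1 h))
      exact ⟨(le_min_iff.1 h3).1, h1, (le_min_iff.1 h3).2⟩
  rw [hset]
  have hint : IntegrableOn (fun t => f t / c) (Ioc u x') volume :=
    (hfi.1.mono_set (Ioc_subset_Ioc_right hx'v)).div_const c
  have hnn : 0 ≤ᵐ[volume.restrict (Ioc u x')] fun t => f t / c := by
    filter_upwards [ae_restrict_mem measurableSet_Ioc] with t ht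
    exact div_nonneg (hf0 t ⟨ht.1.le, ht.2.trans hx'v⟩) hc.le
  rw [← ofReal_integral_eq_lintegral_ofReal hint hnn, integral_div,
    ← intervalIntegral.integral_of_le hux']

/-- Total mass of the normalised density: `1` when `∫_u^v f = c > 0`. [folklore] -/
private theorem isProbabilityMeasure_withDensity {u v : ℝ} (huv : u ≤ v) {f : ℝ → ℝ}
    (hfi : IntervalIntegrable f volume u v) (hf0 : ∀ x ∈ Icc u v, 0 ≤ f x) {c : ℝ} (hc : 0 < c)
    (hfc : ∫ t in u..v, f t = c) :
    IsProbabilityMeasure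
      ((volume.restrict (Ioc u v)).withDensity (fun t => ENNReal.ofReal (f t / c))) := by
  constructor
  rw [withDensity_apply _ MeasurableSet.univ, Measure.restrict_univ]
  have hint : IntegrableOn (fun t => f t / c) (Ioc u v) volume := hfi.1.div_const c
  have hnn : 0 ≤ᵐ[volume.restrict (Ioc u v)] fun t => f t / c := by
    filter_upwards [ae_restrict_mem measurableSet_Ioc] with t ht
    exact div_nonneg (hf0 t ⟨ht.1.le, ht.2⟩) hc.le
  rw [← ofReal_integral_eq_lintegral_ofReal hint hnn, integral_div,
    ← intervalIntegral.integral_of_le huv, hfc, div_self hc.ne', ENNReal.ofReal_one]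

/-- Integration against the normalised density: `∫ ψ d((f/c)·dx|_(u,v]) = (∫_u^v f ψ)/c`. [folklore] -/
private theorem integral_withDensity_eq {u v : ℝ} (huv : u ≤ v) {f : ℝ → ℝ}
    (hfi : IntervalIntegrable f volume u v) (hf0 : ∀ x ∈ Icc u v, 0 ≤ f x) {c : ℝ} (hc : 0 < c)
    (ψ : ℝ → ℝ) :
    ∫ x, ψ x ∂((volume.restrict (Ioc u v)).withDensity (fun t => ENNReal.ofReal (f t / c))) =
      (∫ x in u..v, f x * ψ x) / c := by
  have hmeas : AEMeasurable (fun t => ENNReal.ofReal (f t / c)) (volume.restrict (Ioc u v)) :=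
    (hfi.1.aestronglyMeasurable.aemeasurable.div_const c).ennreal_ofReal
  rw [integral_withDensity_eq_integral_toReal_smul₀ hmeas
    (Eventually.of_forall fun _ => ENNReal.ofReal_lt_top) ψ,
    intervalIntegral.integral_of_le huv, ← integral_div]
  refine integral_congr_ae ?_
  filter_upwards [ae_restrict_mem measurableSet_Ioc] with t ht
  rw [ENNReal.toReal_ofReal (div_nonneg (hf0 t ⟨ht.1.le, ht.2⟩) hc.le), smul_eq_mul]
  ring

/-- `|∫_u^v f ψ| ≤ B ∫_u^v f` for `f ≥ 0` on `[u, v]` and `|ψ| ≤ B`. [folklore] -/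
private theorem abs_intervalIntegral_mul_le {u v : ℝ} (huv : u ≤ v) {f ψ : ℝ → ℝ}
    (hfi : IntervalIntegrable f volume u v) (hf0 : ∀ x ∈ Icc u v, 0 ≤ f x) {B : ℝ}
    (hψB : ∀ x, |ψ x| ≤ B) (hψm : AEStronglyMeasurable ψ (volume.restrict (Icc u v))) :
    |∫ x in u..v, f x * ψ x| ≤ B * ∫ x in u..v, f x := by
  have hB0 : 0 ≤ B := (abs_nonneg _).trans (hψB 0)
  have hψm' : AEStronglyMeasurable ψ (volume.restrict (Ioc u v)) :=
    hψm.mono_measure (Measure.restrict_mono Ioc_subset_Icc_self le_rfl)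
  have hint : Integrable (fun x => f x * ψ x) (volume.restrict (Ioc u v)) := by
    have h := Integrable.bdd_mul (c := B) hfi.1 hψm'
      (Eventually.of_forall fun x => by rw [Real.norm_eq_abs]; exact hψB x)
    simpa only [mul_comm] using h
  rw [intervalIntegral.integral_of_le huv, intervalIntegral.integral_of_le huv, ← integral_const_mul]
  calc |∫ x in Ioc u v, f x * ψ x| ≤ ∫ x in Ioc u v, |f x * ψ x| := abs_integral_le_integral_abs
    _ ≤ ∫ x in Ioc u v, B * f x := by
        refine integral_mono_ae hint.abs (hfi.1.const_mul B) ?_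
        filter_upwards [ae_restrict_mem measurableSet_Ioc] with x hx
        rw [abs_mul, mul_comm]
        exact mul_le_mul (hψB x) (abs_of_nonneg (hf0 x ⟨hx.1.le, hx.2⟩)).le (abs_nonneg _) hB0

/-! ### Window integrals ⇒ test functions, on an interval carrying no point mass -/

/-- **Distribution functions ⇒ bounded a.e.-continuous test functions** (technical form: `ψ` globally
bounded, a.e.-strongly measurable on `[u, v]` and continuous at almost every point of `(u, v]`): if
`F_T ≥ 0` (eventually) are continuous, `w ≥ 0` is continuous on `[u, v]`, and `∫_u^x F_T → ∫_u^x w` for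
every `x ∈ [u, v]`, along an arbitrary countably generated filter `l` in the parameter (no `T → ∞`
hard-wired, no AH-Pairs data inside), then `∫_u^v F_i ψ → ∫_u^v w ψ` along `l`.  This is the
"by approximation this also holds for any Riemann integrable function" step of BGSTB 2025, §7, done by weak
convergence (Resnick Thm 8.4.1 + Billingsley Thm 2.7) instead of step functions.
[cite: BaluyotGoldstonSuriajayaTurnageButterbaugh2025, §7 (proof of Theorem 3), TeX l.1049–1090] -/
theorem tendsto_intervalIntegral_mul_of_bounded {ι : Type*} {l : Filter ι} [l.IsCountablyGenerated]
    {F : ι → ℝ → ℝ} {w ψ : ℝ → ℝ} {u v B : ℝ}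
    (huv : u ≤ v) (hFc : ∀ i, Continuous (F i)) (hF0 : ∀ᶠ i in l, ∀ x ∈ Icc u v, 0 ≤ F i x)
    (hwc : ContinuousOn w (Icc u v)) (hw0 : ∀ x ∈ Icc u v, 0 ≤ w x)
    (hA : ∀ x ∈ Icc u v, Tendsto (fun i => ∫ t in u..x, F i t) l (𝓝 (∫ t in u..x, w t)))
    (hψB : ∀ x, |ψ x| ≤ B) (hψm : AEStronglyMeasurable ψ (volume.restrict (Icc u v)))
    (hψc : ∀ᵐ x ∂(volume.restrict (Ioc u v)), ContinuousAt ψ x) :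
    Tendsto (fun i => ∫ x in u..v, F i x * ψ x) l (𝓝 (∫ x in u..v, w x * ψ x)) := by
  have hB0 : 0 ≤ B := (abs_nonneg _).trans (hψB 0)
  have hFi : ∀ i, IntervalIntegrable (F i) volume u v := fun i => (hFc i).intervalIntegrable _ _
  have hwi : IntervalIntegrable w volume u v :=
    (ContinuousOn.mono hwc (by rw [uIcc_of_le huv])).intervalIntegrable
  -- masses
  set m : ℝ := ∫ t in u..v, w t with hm
  have hm0 : 0 ≤ m := intervalIntegral.integral_nonneg huv hw0
  have hmT : Tendsto (fun i => ∫ t in u..v, F i t) l (𝓝 m) := hA v (right_mem_Icc.2 huv)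
  rcases hm0.eq_or_lt with hmz | hmpos
  · -- degenerate case `∫ w = 0`: both sides are `O(B · mass)`
    have hlim0 : ∫ x in u..v, w x * ψ x = 0 := by
      have h := abs_intervalIntegral_mul_le huv hwi hw0 hψB hψm
      rw [← hm, ← hmz, mul_zero] at h
      exact abs_nonpos_iff.1 h
    rw [hlim0]
    refine squeeze_zero_norm' ?_ (by simpa [← hmz] using hmT.const_mul B)
    filter_upwards [hF0] with i hi
    rw [Real.norm_eq_abs]
    exact abs_intervalIntegral_mul_le huv (hFi i) hi hψB hψm
  -- main case `m > 0`: along sequences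
  rw [tendsto_iff_seq_tendsto]
  intro T hT
  set mT : ℕ → ℝ := fun n => ∫ t in u..v, F (T n) t with hmTdef
  have hmTn : Tendsto mT atTop (𝓝 m) := hmT.comp hT
  have hF0n : ∀ᶠ n in atTop, ∀ x ∈ Icc u v, 0 ≤ F (T n) x := hT.eventually hF0
  have hmTpos : ∀ᶠ n in atTop, 0 < mT n := hmTn.eventually (eventually_gt_nhds hmpos)
  -- the normalised densities
  set dens : (ℝ → ℝ) → ℝ → Measure ℝ := fun f c =>
    (volume.restrict (Ioc u v)).withDensity fun t => ENNReal.ofReal (f t / c) with hdens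
  have hac : ∀ (f : ℝ → ℝ) (c : ℝ), dens f c ≪ volume.restrict (Icc u v) := fun f c =>
    (withDensity_absolutelyContinuous _ _).trans
      (Measure.absolutelyContinuous_of_le (Measure.restrict_mono Ioc_subset_Icc_self le_rfl))
  have hPprob : IsProbabilityMeasure (dens w m) :=
    isProbabilityMeasure_withDensity huv hwi hw0 hmpos rfl
  set P : ProbabilityMeasure ℝ := ⟨dens w m, hPprob⟩ with hPdef
  have hPcoe : (P : Measure ℝ) = dens w m := rfl
  -- the approximating probability measures (equal to `P` before the hypotheses kick in)
  have hQex : ∀ n : ℕ, ∃ Q : ProbabilityMeasure ℝ,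
      ((0 < mT n ∧ ∀ x ∈ Icc u v, 0 ≤ F (T n) x) → (Q : Measure ℝ) = dens (F (T n)) (mT n)) ∧
        (Q : Measure ℝ) ≪ volume.restrict (Icc u v) := by
    intro n
    by_cases h : 0 < mT n ∧ ∀ x ∈ Icc u v, 0 ≤ F (T n) x
    · exact ⟨⟨dens (F (T n)) (mT n), isProbabilityMeasure_withDensity huv (hFi _) h.2 h.1 rfl⟩,
        fun _ => rfl, hac _ _⟩
    · exact ⟨P, fun h' => absurd h' h, hac _ _⟩
  choose Q hQ hQac using hQex
  have hQev : ∀ᶠ n in atTop, (Q n : Measure ℝ) = dens (F (T n)) (mT n) := by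
    filter_upwards [hmTpos, hF0n] with n h1 h2 using hQ n ⟨h1, h2⟩
  -- Step 1: the distribution functions converge at every point
  have hcdf : ∀ x : ℝ, Tendsto (fun n => cdf (Q n : Measure ℝ) x) atTop
      (𝓝 (cdf (P : Measure ℝ) x)) := by
    intro x
    set x' : ℝ := max u (min x v) with hx'def
    have hx' : x' ∈ Icc u v := ⟨le_max_left _ _, max_le huv (min_le_right _ _)⟩
    have hlimx : Tendsto (fun n => (∫ t in u..x', F (T n) t) / mT n) atTop
        (𝓝 ((∫ t in u..x', w t) / m)) := ((hA x' hx').comp hT).div hmTn hmpos.ne'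
    have hP : cdf (P : Measure ℝ) x = (∫ t in u..x', w t) / m := by
      rw [cdf_eq_real, measureReal_def, hPcoe, hdens, withDensity_Iic huv hwi hw0 hmpos x,
        ENNReal.toReal_ofReal]
      exact div_nonneg (intervalIntegral.integral_nonneg hx'.1
        (fun t ht => hw0 t ⟨ht.1, ht.2.trans hx'.2⟩)) hmpos.le
    rw [hP]
    refine hlimx.congr' ?_
    filter_upwards [hQev, hmTpos, hF0n] with n hn h1 h2
    rw [cdf_eq_real, measureReal_def, hn, hdens, withDensity_Iic huv (hFi _) h2 h1 x,
      ENNReal.toReal_ofReal]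
    exact div_nonneg (intervalIntegral.integral_nonneg hx'.1
      (fun t ht => h2 t ⟨ht.1, ht.2.trans hx'.2⟩)) h1.le
  -- Step 2: weak convergence (Resnick Thm 8.4.1)
  have hweak : Tendsto Q atTop (𝓝 P) :=
    Literature.Probability.Distributions.WeakConvergenceCDF.tendsto_of_forall_continuousAt_tendsto_cdf
      (μs := Q) (μ := P) (fun x _ => hcdf x)
  -- Step 3: the mapping theorem for the a.e.-continuous bounded `ψ` (Billingsley Thm 2.7)
  have hψQ : ∀ n, AEMeasurable ψ (Q n : Measure ℝ) := fun n => (hψm.mono_ac (hQac n)).aemeasurable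
  have hψP : AEMeasurable ψ (P : Measure ℝ) := (hψm.mono_ac (hac w m)).aemeasurable
  have hcontP : ∀ᵐ x ∂(P : Measure ℝ), ContinuousAt ψ x := by
    rw [hPcoe, hdens]
    exact (withDensity_absolutelyContinuous _ _).ae_le hψc
  have hmap := Literature.Probability.Process.ProbabilityMeasure.tendsto_map_of_ae_continuousAt
    hweak hψQ hψP hcontP
  -- the bounded continuous truncation of the identity at level `B`
  set tr : ℝ →ᵇ ℝ := BoundedContinuousFunction.mkOfBound
    ⟨fun y => max (-B) (min B y), (continuous_const.max (continuous_const.min continuous_id))⟩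
    (2 * B) (fun y z => by
      simp only [ContinuousMap.coe_mk, Real.dist_eq]
      have h1 : -B ≤ max (-B) (min B y) := le_max_left _ _
      have h2 : max (-B) (min B y) ≤ B := max_le (by linarith) (min_le_left _ _)
      have h3 : -B ≤ max (-B) (min B z) := le_max_left _ _
      have h4 : max (-B) (min B z) ≤ B := max_le (by linarith) (min_le_left _ _)
      rw [abs_le]; constructor <;> linarith) with htrdef
  have htr_apply : ∀ y, tr y = max (-B) (min B y) := fun y => rfl
  have htrψ : ∀ x, tr (ψ x) = ψ x := by
    intro x
    rw [htr_apply]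
    have hx := abs_le.1 (hψB x)
    rw [min_eq_right hx.2, max_eq_right hx.1]
  have hint := (ProbabilityMeasure.tendsto_iff_forall_integral_tendsto.1 hmap) tr
  have hiQ : ∀ n, ∫ y, tr y ∂(((Q n).map (hψQ n) : ProbabilityMeasure ℝ) : Measure ℝ) =
      ∫ x, ψ x ∂(Q n : Measure ℝ) := by
    intro n
    rw [ProbabilityMeasure.toMeasure_map, integral_map (hψQ n) tr.continuous.aestronglyMeasurable]
    simp only [htrψ]
  have hiP : ∫ y, tr y ∂((P.map hψP : ProbabilityMeasure ℝ) : Measure ℝ) =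
      ∫ x, ψ x ∂(P : Measure ℝ) := by
    rw [ProbabilityMeasure.toMeasure_map, integral_map hψP tr.continuous.aestronglyMeasurable]
    simp only [htrψ]
  simp only [hiQ, hiP] at hint
  -- Step 4: un-normalise
  have hfin : Tendsto (fun n => mT n * ∫ x, ψ x ∂(Q n : Measure ℝ)) atTop
      (𝓝 (m * ∫ x, ψ x ∂(P : Measure ℝ))) := hmTn.mul hint
  have hPint : m * ∫ x, ψ x ∂(P : Measure ℝ) = ∫ x in u..v, w x * ψ x := by
    rw [hPcoe, hdens, integral_withDensity_eq huv hwi hw0 hmpos ψ]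
    field_simp
  rw [hPint] at hfin
  refine hfin.congr' ?_
  filter_upwards [hQev, hmTpos, hF0n] with n hn h1 h2
  rw [Function.comp_apply, hn, hdens, integral_withDensity_eq huv (hFi _) h2 h1 ψ]
  field_simp

/-- **Window integrals ⇒ Riemann-integrable test functions** (BGSTB 2025, §7: "Thus by approximation this
also holds for any Riemann integrable function `g(α)`"), on an interval carrying no point mass: if
`F_i ≥ 0` (eventually along a countably generated filter `l`) are continuous, `w ≥ 0` is continuous on
`[u, v]`, `∫_u^x F_i → ∫_u^x w` along `l` for every `x ∈ [u, v]`, and `g` is bounded on `[u, v]` and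
continuous within `[u, v]` at almost every point (the "Riemann integrable" binder of the typed
`bgstb2025_theorem3`), then `∫_u^v F_i g → ∫_u^v w g` along `l` (no `T`, `M`, `R`, `E_G` inside: the
AH-Pairs bookkeeping is the Theorem-3 assembler's).
[cite: BaluyotGoldstonSuriajayaTurnageButterbaugh2025, §7 (proof of Theorem 3), TeX l.1049–1090] -/
theorem tendsto_intervalIntegral_mul_of_tendsto_intervalIntegral {ι : Type*} {l : Filter ι}
    [l.IsCountablyGenerated] {F : ι → ℝ → ℝ} {w g : ℝ → ℝ}
    {u v B : ℝ} (huv : u ≤ v) (hFc : ∀ i, Continuous (F i))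
    (hF0 : ∀ᶠ i in l, ∀ x ∈ Icc u v, 0 ≤ F i x)
    (hwc : ContinuousOn w (Icc u v)) (hw0 : ∀ x ∈ Icc u v, 0 ≤ w x)
    (hA : ∀ x ∈ Icc u v, Tendsto (fun i => ∫ t in u..x, F i t) l (𝓝 (∫ t in u..x, w t)))
    (hgB : ∀ x ∈ Icc u v, |g x| ≤ B)
    (hgc : ∀ᵐ x ∂(volume.restrict (Icc u v)), ContinuousWithinAt g (Icc u v) x) :
    Tendsto (fun i => ∫ x in u..v, F i x * g x) l (𝓝 (∫ x in u..v, w x * g x)) := by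
  have hB0 : 0 ≤ B := (abs_nonneg _).trans (hgB u (left_mem_Icc.2 huv))
  -- the clamp `g_B = max(−B, min(B, g))` agrees with `g` on `[u, v]`
  set gB : ℝ → ℝ := fun x => max (-B) (min B (g x)) with hgBdef
  have hclamp : Continuous fun y : ℝ => max (-B) (min B y) :=
    continuous_const.max (continuous_const.min continuous_id)
  have hgB_eq : ∀ x ∈ Icc u v, gB x = g x := by
    intro x hx
    have h := abs_le.1 (hgB x hx)
    simp only [hgBdef, min_eq_right h.2, max_eq_right h.1]
  have hgB_bd : ∀ x, |gB x| ≤ B := by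
    intro x
    rw [abs_le]
    exact ⟨le_max_left _ _, max_le (by linarith) (min_le_left _ _)⟩
  have hgBm : AEStronglyMeasurable gB (volume.restrict (Icc u v)) :=
    hclamp.comp_aestronglyMeasurable (aestronglyMeasurable_of_ae_continuousWithinAt hgc)
  have hgBc : ∀ᵐ x ∂(volume.restrict (Ioc u v)), ContinuousAt gB x := by
    have hv : ∀ᵐ x ∂(volume.restrict (Ioc u v)), x ≠ v := by
      refine ae_restrict_of_ae ?_
      have h0 : (volume : Measure ℝ) {x | ¬ x ≠ v} = 0 := by
        simp only [not_not, setOf_eq_eq_singleton, measure_singleton]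
      exact ae_iff.2 h0
    filter_upwards [hv, ae_restrict_mem measurableSet_Ioc,
      ae_restrict_of_ae_restrict_of_subset Ioc_subset_Icc_self hgc] with x hxv hx hc
    have hxI : Icc u v ∈ 𝓝 x := Icc_mem_nhds hx.1 (lt_of_le_of_ne hx.2 hxv)
    exact hclamp.continuousAt.comp (hc.continuousAt hxI)
  have hcongr : ∀ f : ℝ → ℝ, ∫ x in u..v, f x * g x = ∫ x in u..v, f x * gB x := by
    intro f
    refine intervalIntegral.integral_congr fun x hx => ?_
    rw [uIcc_of_le huv] at hx
    simp only [hgB_eq x hx]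
  have h1 : (fun i => ∫ x in u..v, F i x * g x) = fun i => ∫ x in u..v, F i x * gB x :=
    funext fun i => hcongr (F i)
  rw [h1, hcongr w]
  exact tendsto_intervalIntegral_mul_of_bounded huv hFc hF0 hwc hw0 hA hgB_bd hgBm hgBc

/-! ### Uniform window averages ⇒ distribution functions (the tiling step) -/

/-- **Tiling**: if the window averages `(1/2λ) ∫_{α−λ}^{α+λ} F_i` are, along `l`, uniformly within `ε` of
`w(α)` for all windows inside `[u, v]` — for every `ε > 0` and all small `λ` (the shape of BGSTB 2025,
Lemma 6 (ii) on an integer-free interval, after the `T → ∞`, `M → ∞` bookkeeping) — and `w` is continuous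
on `[u, v]`, then the distribution functions converge: `∫_u^x F_i → ∫_u^x w` along `l` for every
`x ∈ [u, v]` (tile `[u, x]` by `N` windows of width `2λ = (x − u)/N`; Riemann sum of `w` by uniform
continuity).  [cite: BaluyotGoldstonSuriajayaTurnageButterbaugh2025, §7 (proof of Theorem 3), TeX l.1049–1090] -/
theorem tendsto_intervalIntegral_of_window {ι : Type*} {l : Filter ι} {F : ι → ℝ → ℝ} {w : ℝ → ℝ}
    {u v : ℝ} (hFc : ∀ i, Continuous (F i)) (hwc : ContinuousOn w (Icc u v))
    (hwin : ∀ ε > 0, ∃ lam0 > 0, ∀ lam : ℝ, 0 < lam → lam ≤ lam0 → ∀ᶠ i in l, ∀ α : ℝ,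
      u ≤ α - lam → α + lam ≤ v →
        |1 / (2 * lam) * (∫ β in (α - lam)..(α + lam), F i β) - w α| ≤ ε)
    {x : ℝ} (hx : x ∈ Icc u v) :
    Tendsto (fun i => ∫ t in u..x, F i t) l (𝓝 (∫ t in u..x, w t)) := by
  rcases hx.1.eq_or_lt with hux | hux
  · -- `x = u`: both sides vanish
    subst hux
    simp only [intervalIntegral.integral_same]
    exact tendsto_const_nhds
  set L : ℝ := x - u with hL
  have hL0 : 0 < L := by rw [hL]; linarith
  have hwu : UniformContinuousOn w (Icc u v) := isCompact_Icc.uniformContinuousOn_of_continuous hwc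
  rw [Metric.tendsto_nhds]
  intro ε' hε'
  -- error budget: `ε = ε'/(4L)` for the windows and for the Riemann sum of `w`
  set ε : ℝ := ε' / (4 * L) with hε
  have hε0 : 0 < ε := by positivity
  obtain ⟨lam0, hlam0, hW⟩ := hwin ε hε0
  obtain ⟨δ, hδ, hδw⟩ := Metric.uniformContinuousOn_iff.1 hwu ε hε0
  -- number of windows and their half-width
  set N : ℕ := ⌈L / (2 * min lam0 (δ / 2))⌉₊ + 1 with hN
  have hmin : 0 < min lam0 (δ / 2) := lt_min hlam0 (by linarith)
  have hN0 : (0 : ℝ) < N := by rw [hN]; positivity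
  have hNge : L / (2 * min lam0 (δ / 2)) ≤ N := by
    rw [hN]; push_cast
    exact (Nat.le_ceil _).trans (by linarith)
  set lam : ℝ := L / (2 * N) with hlam
  have hlam_pos : 0 < lam := by positivity
  have hlam_le : lam ≤ min lam0 (δ / 2) := by
    rw [hlam, div_le_iff₀ (by positivity)]
    have := (div_le_iff₀ (by positivity : (0:ℝ) < 2 * min lam0 (δ / 2))).1 hNge
    linarith
  have hlam0' : lam ≤ lam0 := hlam_le.trans (min_le_left _ _)
  have hlamδ : lam < δ := lt_of_le_of_lt (hlam_le.trans (min_le_right _ _)) (by linarith)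
  have h2lamN : 2 * lam * N = L := by rw [hlam]; field_simp
  -- the grid `a k = u + 2λk`
  set a : ℕ → ℝ := fun k => u + 2 * lam * k with ha
  have ha0 : a 0 = u := by simp [ha]
  have haN : a N = x := by simp only [ha]; rw [h2lamN, hL]; ring
  have ha_succ : ∀ k : ℕ, a (k + 1) = a k + 2 * lam := by intro k; simp only [ha]; push_cast; ring
  have ha_ge : ∀ k : ℕ, u ≤ a k := fun k => by
    simp only [ha]; nlinarith [hlam_pos.le, (Nat.cast_nonneg k : (0:ℝ) ≤ k)]
  have ha_le : ∀ k : ℕ, k ≤ N → a k ≤ x := by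
    intro k hk
    have : 2 * lam * (k : ℝ) ≤ 2 * lam * N :=
      mul_le_mul_of_nonneg_left (by exact_mod_cast hk) (by positivity)
    simp only [ha]; linarith [h2lamN]
  filter_upwards [hW lam hlam_pos hlam0'] with i hi
  -- interval integrability on the cells
  have hFi : ∀ k < N, IntervalIntegrable (F i) volume (a k) (a (k + 1)) :=
    fun k _ => (hFc i).intervalIntegrable _ _
  have hwI : ∀ k < N, IntervalIntegrable w volume (a k) (a (k + 1)) := by
    intro k hk
    refine (hwc.mono fun t ht => ?_).intervalIntegrable
    rw [uIcc_of_le (by rw [ha_succ]; linarith)] at ht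
    exact ⟨(ha_ge k).trans ht.1, (ht.2.trans (ha_le (k + 1) (by omega))).trans hx.2⟩
  have hsumF := intervalIntegral.sum_integral_adjacent_intervals hFi
  have hsumw := intervalIntegral.sum_integral_adjacent_intervals hwI
  rw [ha0, haN] at hsumF hsumw
  rw [Real.dist_eq, ← hsumF, ← hsumw, ← Finset.sum_sub_distrib]
  -- the estimate on one cell: `|∫ F − ∫ w| ≤ 4λε`
  have hcell : ∀ k ∈ Finset.range N,
      |(∫ t in a k..a (k + 1), F i t) - ∫ t in a k..a (k + 1), w t| ≤ 4 * lam * ε := by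
    intro k hk
    rw [Finset.mem_range] at hk
    set α : ℝ := a k + lam with hα
    have h1 : a k = α - lam := by rw [hα]; ring
    have h2 : a (k + 1) = α + lam := by rw [ha_succ, hα]; ring
    have hαu : u ≤ α - lam := by rw [← h1]; exact ha_ge k
    have hαv : α + lam ≤ v := by rw [← h2]; exact (ha_le (k + 1) (by omega)).trans hx.2
    -- the window hypothesis, un-normalised
    have hF : |(∫ t in a k..a (k + 1), F i t) - 2 * lam * w α| ≤ 2 * lam * ε := by
      have h := hi α hαu hαv
      rw [h1, h2]
      have e : (∫ β in (α - lam)..(α + lam), F i β) - 2 * lam * w α =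
          (2 * lam) * (1 / (2 * lam) * (∫ β in (α - lam)..(α + lam), F i β) - w α) := by
        field_simp
      rw [e, abs_mul, abs_of_pos (by positivity : (0:ℝ) < 2 * lam)]
      exact mul_le_mul_of_nonneg_left h (by positivity)
    -- the Riemann-sum error of `w` on the cell
    have hw : |(∫ t in a k..a (k + 1), w t) - 2 * lam * w α| ≤ 2 * lam * ε := by
      have hwk := hwI k hk
      have e : (∫ t in a k..a (k + 1), w t) - 2 * lam * w α =
          ∫ t in a k..a (k + 1), (w t - w α) := by
        rw [intervalIntegral.integral_sub hwk intervalIntegrable_const, intervalIntegral.integral_const,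
          h2, h1, smul_eq_mul]
        ring
      rw [e]
      have hb : ∀ t ∈ Ι (a k) (a (k + 1)), ‖w t - w α‖ ≤ ε := by
        intro t ht
        rw [uIoc_of_le (by rw [ha_succ]; linarith)] at ht
        have htI : t ∈ Icc u v :=
          ⟨(ha_ge k).trans ht.1.le, (ht.2.trans (ha_le (k + 1) (by omega))).trans hx.2⟩
        have hαI : α ∈ Icc u v := ⟨by linarith [hlam_pos], by linarith [hlam_pos]⟩
        have hdist : dist t α < δ := by
          rw [Real.dist_eq, abs_lt]
          rw [h1] at ht; rw [h2] at ht
          constructor <;> linarith [ht.1, ht.2]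
        have := hδw t htI α hαI hdist
        rw [Real.dist_eq] at this
        rw [Real.norm_eq_abs]; exact this.le
      have hn := intervalIntegral.norm_integral_le_of_norm_le_const hb
      have hlen : |a (k + 1) - a k| = 2 * lam := by
        rw [ha_succ, show a k + 2 * lam - a k = 2 * lam by ring,
          abs_of_pos (by positivity : (0:ℝ) < 2 * lam)]
      rw [Real.norm_eq_abs, hlen] at hn
      linarith
    have := abs_sub_le (∫ t in a k..a (k + 1), F i t) (2 * lam * w α) (∫ t in a k..a (k + 1), w t)
    rw [abs_sub_comm (2 * lam * w α)] at this
    linarith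
  calc |∑ k ∈ Finset.range N, ((∫ t in a k..a (k + 1), F i t) - ∫ t in a k..a (k + 1), w t)|
      ≤ ∑ k ∈ Finset.range N, |(∫ t in a k..a (k + 1), F i t) - ∫ t in a k..a (k + 1), w t| :=
        Finset.abs_sum_le_sum_abs _ _
    _ ≤ ∑ k ∈ Finset.range N, 4 * lam * ε := Finset.sum_le_sum hcell
    _ = 2 * L * ε := by rw [Finset.sum_const, Finset.card_range, nsmul_eq_mul, ← h2lamN]; ring
    _ < ε' := by rw [hε]; field_simp; linarith

/-! ### The window around an atom -/

/-- **Atom window** (BGSTB 2025, §7: "Next consider a function `g(α)` which is Lipschitz continuous at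
`α = N ∈ ℤ`. Then `∫_{N−λ}^{N+λ} F(α) g(α) dα ∼ g(N) ∫_{N−λ}^{N+λ} 𝓕(α) dα`"): for `F ≥ 0` on `[a, b]` and
`|g − g(m)| ≤ ω` on `[a, b]` (a continuity modulus of `g` at `m` on the window; Lipschitz at `m` gives
`ω = Cλ`), `|∫_a^b F g − g(m) ∫_a^b F| ≤ ω ∫_a^b F` — pure real analysis, no `T`.
[cite: BaluyotGoldstonSuriajayaTurnageButterbaugh2025, §7 (proof of Theorem 3), TeX l.1049–1090] -/
theorem abs_intervalIntegral_mul_sub_mul_le {F g : ℝ → ℝ} {a b ω : ℝ} (hab : a ≤ b) (m : ℝ)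
    (hFi : IntervalIntegrable F volume a b) (hF0 : ∀ x ∈ Icc a b, 0 ≤ F x)
    (hgm : AEStronglyMeasurable g (volume.restrict (Icc a b)))
    (hg : ∀ x ∈ Icc a b, |g x - g m| ≤ ω) :
    |(∫ x in a..b, F x * g x) - g m * ∫ x in a..b, F x| ≤ ω * ∫ x in a..b, F x := by
  have hω : 0 ≤ ω := (abs_nonneg _).trans (hg a (left_mem_Icc.2 hab))
  -- the clamp of `g − g(m)` at level `ω` agrees with `g − g(m)` on `[a, b]`
  set ψ : ℝ → ℝ := fun x => max (-ω) (min ω (g x - g m)) with hψdef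
  have hclamp : Continuous fun y : ℝ => max (-ω) (min ω y) :=
    continuous_const.max (continuous_const.min continuous_id)
  have hψ_eq : ∀ x ∈ Icc a b, ψ x = g x - g m := by
    intro x hx
    have h := abs_le.1 (hg x hx)
    simp only [hψdef, min_eq_right h.2, max_eq_right h.1]
  have hψ_bd : ∀ x, |ψ x| ≤ ω := by
    intro x
    rw [abs_le]
    exact ⟨le_max_left _ _, max_le (by linarith) (min_le_left _ _)⟩
  have hψm : AEStronglyMeasurable ψ (volume.restrict (Icc a b)) :=
    hclamp.comp_aestronglyMeasurable (hgm.sub aestronglyMeasurable_const)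
  have hψm' : AEStronglyMeasurable ψ (volume.restrict (Ioc a b)) :=
    hψm.mono_measure (Measure.restrict_mono Ioc_subset_Icc_self le_rfl)
  have hFψ : IntervalIntegrable (fun x => F x * ψ x) volume a b := by
    rw [intervalIntegrable_iff_integrableOn_Ioc_of_le hab, IntegrableOn]
    have h := Integrable.bdd_mul (c := ω) hFi.1 hψm'
      (Eventually.of_forall fun x => by rw [Real.norm_eq_abs]; exact hψ_bd x)
    simpa only [mul_comm] using h
  have e1 : ∫ x in a..b, F x * g x = ∫ x in a..b, (F x * ψ x + g m * F x) := by
    refine intervalIntegral.integral_congr fun x hx => ?_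
    rw [uIcc_of_le hab] at hx
    simp only [hψ_eq x hx]
    ring
  rw [e1, intervalIntegral.integral_add hFψ (hFi.const_mul (g m)), intervalIntegral.integral_const_mul,
    add_sub_cancel_right]
  exact abs_intervalIntegral_mul_le hab hFi hF0 hψ_bd hψm

end Literature.NumberTheory.LFunctions.AH

end
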